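import Summits.BirchSwinnertonDyer.BirchSwinnertonDyer.Theorems.QuadraticBranchSignedControlPlusEtaNonsurjMultiplicativeFrobeniusScalar
import HarnessLib

/-!
# Route `QuadraticBranchSignedControl` (rung K8, cell `bsd-potss`): crux stmt-BirchSwinnertonDyer-19606
# `PlusEtaMainConjectureNonsurj` — THE LEVEL-RAISING SHAPE FOR EVERY FROBENIUS: `tr ρ̄_{V,p}(σ) = a_ℓ(V)·(ℓ+1)` in `𝔽_p`
# for every arithmetic Frobenius `σ` at every prime `𝔓 ∣ ℓ` of `ℤ̄`, `ℓ ≠ p` a multiplicative prime of a row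

WHAT. `…PlusEtaNonsurjMultiplicativeFrobeniusScalar` proved the trace form for the restriction `τ|_{ℚ̄}` of a LOCAL arithmetic
Frobenius (`trace_resGalOfEmb_eq_lFunction_mul_of_row`) and the bookkeeping `σ = j · g τ|_{ℚ̄} g⁻¹` on `V[p]` with `j ∈ I_𝔓` acting
trivially (`exists_frob_smul_eq_conj_resGalOfEmb_of_row`). Since the trace is a class function this gives the statement for EVERY
arithmetic Frobenius `σ ∈ Γ_ℚ` at every `𝔓 ∣ ℓ` — the form in which a congruent newform `θ` (`ρ̄_θ ≅ ρ̄_V`) reads it: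
`a_ℓ(θ) ≡ a_ℓ(V)(ℓ + 1) (mod 𝔓)`, `a_ℓ(V) = W.LFunction ℓ = ±1` (FINDING-19606-k8eta-c2-g11 §2b: 7/7 multiplicative primes of the matched rows).

* `matrix_conj_of_smul_eq_conj` — if `σ • P = g • (σ₁ • (g⁻¹ • P))` on `V[p]` then, in any frame `e` with matrices `G`, `M₁` for `g`, `σ₁`,
  the matrix `G * M₁ * G⁻¹` represents `σ` and `G` is invertible (`G * G' = 1` for the matrix `G'` of `g⁻¹`);
* **`trace_frob_eq_lFunction_mul_of_row`** — `LinearMap.trace (ZMod p) V[p] ρ̄(σ) = (V.LFunction ℓ) · (ℓ + 1)` for every arithmetic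
  Frobenius `σ` at every `𝔓 ∣ ℓ` (`Matrix.trace_mul_cycle`).

HONEST FRAMING (cell `bsd-potss`, run/shared/lean/pub/bsd-potss/; FULL-BSD rank ≤ 1 programme): TOOL THEOREMS ONLY (no definition, no named
fact, no `sorry`, axioms standard). Nothing is booked; crux 19606 stays OPEN; `BSD(W, p)` is claimed for no pair. Seat `bsd-potss-k8eta-c2` g12
(prover), `--supports stmt-BirchSwinnertonDyer-19606`.

References: [Serre1972] §1.11–§1.12, §2.2; [SilvermanAEC2009] Exercise 8.19 (a), §C.16; K. Ribet, Invent. Math. 100 (1990) §1;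
F. Diamond, «The refined conjecture of Serre» (1995) (level raising at `ℓ ∥ N`: `a_ℓ ≡ ±(ℓ+1)`).
-/

set_option autoImplicit false
set_option linter.dupNamespace false

noncomputable section

open scoped Classical NNReal

open Matrix Field IsDedekindDomain NumberField WeierstrassCurve Literature.NumberTheory.EllipticCurves
  Literature.NumberTheory.GaloisRepresentations Literature.NumberTheory.SerreUniformity
  Rat.HeightOneSpectrum IsDedekindDomain.HeightOneSpectrum

namespace Summit.BirchSwinnertonDyer.BirchSwinnertonDyer.Theorems.EtaCartanField

section Trace

variable {V : WeierstrassCurve ℚ} {p : ℕ} [hp : Fact p.Prime]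

omit hp in
/-- **Two matrices acting identically on all vectors are equal** (`Matrix.toLin'` is injective). [folklore] -/
theorem matrix_eq_of_forall_mulVec_eq {M N : Matrix (Fin 2) (Fin 2) (ZMod p)} (h : ∀ x : Fin 2 → ZMod p, M *ᵥ x = N *ᵥ x) :
    M = N :=
  Matrix.toLin'.injective (LinearMap.ext fun x => by rw [Matrix.toLin'_apply, Matrix.toLin'_apply, h x])

/-- **Conjugate matrices for conjugate actions.** In a frame `e : V[p] ≃ 𝔽_p²`, if `g`, `g⁻¹`, `σ₁` act through `G`, `G'`, `M₁` and
`σ • P = g • (σ₁ • (g⁻¹ • P))` for all `P`, then `σ` acts through `G * M₁ * G'` and `G' * G = 1`. [folklore] -/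
theorem matrix_conj_of_smul_eq_conj (e : V.geomTorsion p ≃+ (Fin 2 → ZMod p)) {σ σ₁ g : absoluteGaloisGroup ℚ}
    {G G' M₁ : Matrix (Fin 2) (Fin 2) (ZMod p)} (hG : ∀ P : V.geomTorsion p, e (g • P) = G *ᵥ e P)
    (hG' : ∀ P : V.geomTorsion p, e (g⁻¹ • P) = G' *ᵥ e P) (hM₁ : ∀ P : V.geomTorsion p, e (σ₁ • P) = M₁ *ᵥ e P)
    (hσ : ∀ P : V.geomTorsion p, σ • P = g • (σ₁ • (g⁻¹ • P))) :
    (∀ P : V.geomTorsion p, e (σ • P) = (G * M₁ * G') *ᵥ e P) ∧ G' * G = 1 := by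
  refine ⟨fun P => ?_, ?_⟩
  · rw [hσ P, hG, hM₁, hG', Matrix.mulVec_mulVec, Matrix.mulVec_mulVec]
  · refine matrix_eq_of_forall_mulVec_eq fun x => ?_
    obtain ⟨P, rfl⟩ := e.surjective x
    rw [← Matrix.mulVec_mulVec, ← hG, ← hG', ← mul_smul, inv_mul_cancel, one_smul, Matrix.one_mulVec]

end Trace

section Row

variable (V : WeierstrassCurve ℚ) [V.IsElliptic] [V.IsGloballyMinimal] (p : ℕ) [hp : Fact p.Prime]

/-- **The level-raising shape for every Frobenius: `tr ρ̄_{V,p}(σ) = a_ℓ(V)·(ℓ+1)` in `𝔽_p`.** On a row of crux 19606 (`V/ℚ` globally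
minimal, `p ≥ 5` good, `a_p = 0`, tower not onto), for a multiplicative prime `ℓ ≠ p`, a prime `𝔓 ∣ ℓ` of `ℤ̄` and an arithmetic Frobenius
`σ ∈ Γ_ℚ` at `𝔓`: the `𝔽_p`-linear trace of `σ` on `V[p]` is `(V.LFunction ℓ)·(ℓ + 1)`, `V.LFunction ℓ = a_ℓ(V) = ±1` the Hasse–Weil
coefficient (`+1` split, `−1` non-split). (The matrix of `σ` is conjugate to that of the restricted local Frobenius `τ|_{ℚ̄}`, whose trace is
`trace_resGalOfEmb_eq_lFunction_mul_of_row`.) So for any newform `θ` with `ρ̄_θ ≅ ρ̄_{V,p}`: `a_ℓ(θ) ≡ a_ℓ(V)(ℓ+1)`.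
[cite: Serre1972, §2.2, §1.11–§1.12] [cite: SilvermanAEC2009, Exercise 8.19(a) and §C.16] -/
theorem trace_frob_eq_lFunction_mul_of_row (hp5 : 5 ≤ p) (hgood : V.HasGoodReductionAtPrime p) (hap : V.frobeniusTrace p = 0)
    (hns : ¬ ∀ m : ℕ, V.HasSurjectiveModNGaloisRep (p ^ m : ℕ)) (ℓ : ℕ) [hℓ : Fact ℓ.Prime] (hℓp : ℓ ≠ p)
    (hmult : V.HasMultiplicativeReductionAtPrime ℓ) {v : HeightOneSpectrum (𝓞 ℚ)} (hv : (primesEquiv v : ℕ) = ℓ)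
    {𝔓 : Ideal (absIntegers (𝓞 ℚ) ℚ)} (h𝔓 : 𝔓 ∈ v.primesAbove) {σ : absoluteGaloisGroup ℚ} (hσ : IsArithFrobAt (𝓞 ℚ) σ 𝔓) :
    letI : Module (ZMod p) (V.geomTorsion p) := AddSubgroup.torsionBy.zmodModule
    LinearMap.trace (ZMod p) (V.geomTorsion p) ((galoisRepTorsion V p σ).toAdd.toAddMonoidHom.toZModLinearMap p) =
      ((V.LFunction ℓ : ℤ) : ZMod p) * ((ℓ : ZMod p) + 1) := by
  letI : Module (ZMod p) (V.geomTorsion p) := AddSubgroup.torsionBy.zmodModule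
  obtain ⟨g, 𝔐, h𝔐, τ, hτ, hστ⟩ := exists_frob_smul_eq_conj_resGalOfEmb_of_row V p hp5 hgood hap hns ℓ hℓp hmult hv h𝔓 hσ
  set σ₁ := resGalOfEmb (closureEmb (K := ℚ) (v.adicCompletion ℚ)) τ with hσ₁
  obtain ⟨e, ε, hε, himg, -⟩ := hasModPImageEqNonsplitCartanNormalizer_of_row V p hp5 hgood hap hns
  obtain ⟨G, -, hG⟩ := himg g
  obtain ⟨G', -, hG'⟩ := himg g⁻¹
  obtain ⟨M₁, -, hM₁⟩ := himg σ₁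
  obtain ⟨hσM, hGG⟩ := matrix_conj_of_smul_eq_conj e hG hG' hM₁ hστ
  rw [trace_eq_matrix_trace e hσM, Matrix.trace_mul_cycle, hGG, Matrix.one_mul, ← trace_eq_matrix_trace e hM₁, hσ₁]
  exact trace_resGalOfEmb_eq_lFunction_mul_of_row V p hp5 hgood hap hns ℓ hℓp hmult hv h𝔐 hτ

end Row

end Summit.BirchSwinnertonDyer.BirchSwinnertonDyer.Theorems.EtaCartanField

end
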